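import Summits.Parity.GeneralizedHardyLittlewood.Theorems.PrimeLevelFamEdgeMomentsBeyondDiagonalDiagDecorOrderTwoTwoCombine
import HarnessLib

/-!
# Route `PrimeLevelFamEdge`, crux K_A `MomentsBeyondDiagonal` (stmt-Parity-20007), line «petersson_layers» v4, stub `stub_diag`:
# **bookkeeping of the order-`(3,3)` polynomial part (forty pieces, main order `log⁴M`)**

Order-`(3,3)` twin of `…DiagDecorOrderTwoTwoCombine` (p828818) / `…DiagDecorOrderOneThreePoly.orderOneThree_combine`: the
three piece lemmas at main order `ℓ⁴` (`poly33_piece_main/low/hyp`, error `ℓ³`) and the linear bookkeeping `orderThreeThree_combine`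
of the forty monomials of `…DiagDecorOrderThreeThreeSplit.selbergOrderThreeThree_split` against abstract engine facts
(`ττL^m`: `|S_m − KΦ_mℓ^mℓ/ℓ⁴| ≤ C_mℓ^m/ℓ⁴`; `τP₂τL^m` (+ mirror): `…/ℓ²`; `τP₂τP₂L^m`: `…/ℓ⁰`; `M₄`-, `M₆`- and `M₄⊗P₂`-decorated
families: `|·| ≤ Cℓ^p`, `p ≤ 3`). Pure real-number algebra (`poly22_add_piece` reused).

Def-free; theorems only. Helper `--supports stmt-Parity-20007`; closes nothing; K_A, K_B and the Parity summit are NOT proved;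
nothing about Landau–Siegel zeros.

## References
* E. Kowalski, P. Michel, J. VanderKam, J. reine angew. Math. 526 (2000), (23)–(28) pp. 13–15 and Prop. 5.1 p. 18.
  [cite: KowalskiMichelVanderKam2000, (23)–(28) — derivation (order-(3,3) piece of the diagonal main term, general Q)]
-/

noncomputable section

open scoped Real ArithmeticFunction.Moebius

namespace Summit.Parity.GeneralizedHardyLittlewood.Theorems.MomentsBeyondDiagonal.DiagKernel

/-! ### Bookkeeping lemmas at main order `ℓ⁴` (order `(3,3)`: main term `log⁴M`, error `log³M`) -/

/-- A top-degree piece: `|S − KΦℓ^aℓ/ℓ^b| ≤ Cℓ^a/ℓ^b` with `a = b+3` gives `|cS − cKΦℓ⁴| ≤ |c|Cℓ³`. [folklore] -/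
theorem poly33_piece_main {S K Φ C ℓ : ℝ} (c : ℝ) {a b : ℕ} (hℓ : 1 ≤ ℓ) (hab : a = b + 3)
    (h : |S - K * Φ * ℓ ^ a * ℓ / ℓ ^ b| ≤ C * ℓ ^ a / ℓ ^ b) :
    |c * S - c * (K * Φ) * ℓ ^ 4| ≤ |c| * C * ℓ ^ 3 := by
  subst hab
  have hℓ0 : 0 < ℓ := by linarith
  have e1 : K * Φ * ℓ ^ (b + 3) * ℓ / ℓ ^ b = K * Φ * ℓ ^ 4 := by
    rw [div_eq_iff (pow_ne_zero _ hℓ0.ne')]; ring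
  have e2 : C * ℓ ^ (b + 3) / ℓ ^ b = C * ℓ ^ 3 := by
    rw [div_eq_iff (pow_ne_zero _ hℓ0.ne')]; ring
  rw [e1, e2] at h
  rw [show c * S - c * (K * Φ) * ℓ ^ 4 = c * (S - K * Φ * ℓ ^ 4) by ring, abs_mul]
  calc |c| * |S - K * Φ * ℓ ^ 4| ≤ |c| * (C * ℓ ^ 3) := mul_le_mul_of_nonneg_left h (abs_nonneg c)
    _ = |c| * C * ℓ ^ 3 := by ring

/-- A lower-degree piece: `|S − KΦℓ^aℓ/ℓ^b| ≤ Cℓ^a/ℓ^b` with `a ≤ b + 2` gives `|cS − 0·ℓ⁴| ≤ |c|(K|Φ|+C)ℓ³` (`ℓ ≥ 1`).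
[folklore] -/
theorem poly33_piece_low {S K Φ C ℓ : ℝ} (c : ℝ) {a b : ℕ} (hℓ : 1 ≤ ℓ) (hK : 0 ≤ K) (hC : 0 ≤ C) (hab : a ≤ b + 2)
    (h : |S - K * Φ * ℓ ^ a * ℓ / ℓ ^ b| ≤ C * ℓ ^ a / ℓ ^ b) :
    |c * S - 0 * ℓ ^ 4| ≤ |c| * (K * |Φ| + C) * ℓ ^ 3 := by
  have hℓ0 : 0 < ℓ := by linarith
  have hr : ℓ ^ a / ℓ ^ b ≤ ℓ ^ 2 := by
    rw [div_le_iff₀ (pow_pos hℓ0 _), ← pow_add]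
    exact pow_le_pow_right₀ hℓ (by omega)
  have hr0 : 0 ≤ ℓ ^ a / ℓ ^ b := by positivity
  have hℓ23 : ℓ ^ 2 ≤ ℓ ^ 3 := pow_le_pow_right₀ hℓ (by norm_num)
  have hKΦ : 0 ≤ K * |Φ| * ℓ := by positivity
  have h1 : |K * Φ * ℓ ^ a * ℓ / ℓ ^ b| ≤ K * |Φ| * ℓ ^ 3 := by
    rw [show K * Φ * ℓ ^ a * ℓ / ℓ ^ b = K * Φ * ℓ * (ℓ ^ a / ℓ ^ b) by ring, abs_mul, abs_of_nonneg hr0,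
      abs_mul, abs_mul, abs_of_nonneg hK, abs_of_pos hℓ0]
    calc K * |Φ| * ℓ * (ℓ ^ a / ℓ ^ b) ≤ K * |Φ| * ℓ * ℓ ^ 2 := mul_le_mul_of_nonneg_left hr hKΦ
      _ = K * |Φ| * ℓ ^ 3 := by ring
  have h2 : C * ℓ ^ a / ℓ ^ b ≤ C * ℓ ^ 3 := by
    rw [mul_div_assoc]
    calc C * (ℓ ^ a / ℓ ^ b) ≤ C * ℓ ^ 2 := mul_le_mul_of_nonneg_left hr hC
      _ ≤ C * ℓ ^ 3 := mul_le_mul_of_nonneg_left hℓ23 hC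
  have hS : |S| ≤ (K * |Φ| + C) * ℓ ^ 3 := by
    calc |S| = |(S - K * Φ * ℓ ^ a * ℓ / ℓ ^ b) + K * Φ * ℓ ^ a * ℓ / ℓ ^ b| := by congr 1; ring
      _ ≤ |S - K * Φ * ℓ ^ a * ℓ / ℓ ^ b| + |K * Φ * ℓ ^ a * ℓ / ℓ ^ b| := abs_add_le _ _
      _ ≤ C * ℓ ^ a / ℓ ^ b + K * |Φ| * ℓ ^ 3 := add_le_add h h1
      _ ≤ C * ℓ ^ 3 + K * |Φ| * ℓ ^ 3 := by linarith
      _ = (K * |Φ| + C) * ℓ ^ 3 := by ring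
  rw [zero_mul, sub_zero, abs_mul]
  calc |c| * |S| ≤ |c| * ((K * |Φ| + C) * ℓ ^ 3) := mul_le_mul_of_nonneg_left hS (abs_nonneg c)
    _ = |c| * (K * |Φ| + C) * ℓ ^ 3 := by ring

/-- A hypothesis piece: `|S| ≤ Cℓ^p` with `p ≤ 3` gives `|cS − 0·ℓ⁴| ≤ |c|Cℓ³` (`ℓ ≥ 1`). [folklore] -/
theorem poly33_piece_hyp {S C ℓ : ℝ} (c : ℝ) {p : ℕ} (hℓ : 1 ≤ ℓ) (hp : p ≤ 3) (h : |S| ≤ C * ℓ ^ p) :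
    |c * S - 0 * ℓ ^ 4| ≤ |c| * C * ℓ ^ 3 := by
  have hℓ0 : 0 < ℓ := by linarith
  have hC : 0 ≤ C := by
    by_contra hC
    rw [not_le] at hC
    have : C * ℓ ^ p < 0 := mul_neg_of_neg_of_pos hC (pow_pos hℓ0 p)
    linarith [abs_nonneg S]
  have hS : |S| ≤ C * ℓ ^ 3 := h.trans (mul_le_mul_of_nonneg_left (pow_le_pow_right₀ hℓ hp) hC)
  rw [zero_mul, sub_zero, abs_mul]
  calc |c| * |S| ≤ |c| * (C * ℓ ^ 3) := mul_le_mul_of_nonneg_left hS (abs_nonneg c)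
    _ = |c| * C * ℓ ^ 3 := by ring

/-! ### The forty pieces of order `(3,3)` -/
set_option maxHeartbeats 1600000 in
-- forty-term linear bookkeeping
/-- **The bookkeeping of the forty pieces at order `(3,3)`** (`K = (π²/6)²`, `ℓ = log M ≥ 1`): the top-degree pieces `S₇`,
`T₅`, `T₅'`, `U₃` carry the main term `K(Φ₇/896 − (3/320)Ψ₅ + (3/64)Ξ₃)ℓ⁴`, the other thirty-six are `O(ℓ³)`. [folklore] -/
theorem orderThreeThree_combine
    {S₇ S₆ S₅ S₄ S₃ S₂ S₁ S₀ T₅ T₄ T₃ T₂ T₁ T₀ T₅' T₄' T₃' T₂' T₁' T₀' U₃ U₂ U₁ U₀ V₃ V₂ V₁ V₀ W₃ W₂ W₁ W₀ Y₁ Y₀ Z₁ Z₀ R₁ R₀ R₁' R₀' : ℝ}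
    {Φ₇ Φ₆ Φ₅ Φ₄ Φ₃ Φ₂ Φ₁ Φ₀ Ψ₅ Ψ₄ Ψ₃ Ψ₂ Ψ₁ Ψ₀ Ξ₃ Ξ₂ Ξ₁ Ξ₀ : ℝ}
    {C₇ C₆ C₅ C₄ C₃ C₂ C₁ C₀ D₅ D₄ D₃ D₂ D₁ D₀ D₅' D₄' D₃' D₂' D₁' D₀' G₃ G₂ G₁ G₀ A₃ A₂ A₁ A₀ B₃ B₂ B₁ B₀ CY₁ CY₀ CZ₁ CZ₀ CR₁ CR₀ CR₁' CR₀' : ℝ}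
    {E₀₀ E₀₁ E₀₂ E₀₃ E₁₀ E₁₁ E₁₂ E₁₃ E₂₀ E₂₁ E₂₂ E₂₃ E₃₀ E₃₁ E₃₂ E₃₃ μ₂ μ₄ μ₆ ℓ K : ℝ} (hℓ : 1 ≤ ℓ) (hK : 0 ≤ K)
    (hC₆ : 0 ≤ C₆) (hC₅ : 0 ≤ C₅) (hC₄ : 0 ≤ C₄) (hC₃ : 0 ≤ C₃) (hC₂ : 0 ≤ C₂) (hC₁ : 0 ≤ C₁) (hC₀ : 0 ≤ C₀) (hD₄ : 0 ≤ D₄) (hD₃ : 0 ≤ D₃) (hD₂ : 0 ≤ D₂) (hD₁ : 0 ≤ D₁) (hD₀ : 0 ≤ D₀) (hD₄' : 0 ≤ D₄') (hD₃' : 0 ≤ D₃') (hD₂' : 0 ≤ D₂') (hD₁' : 0 ≤ D₁') (hD₀' : 0 ≤ D₀') (hG₂ : 0 ≤ G₂) (hG₁ : 0 ≤ G₁) (hG₀ : 0 ≤ G₀)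
    (h7 : |S₇ - K * Φ₇ * ℓ ^ 7 * ℓ / ℓ ^ 4| ≤ C₇ * ℓ ^ 7 / ℓ ^ 4)
    (h6 : |S₆ - K * Φ₆ * ℓ ^ 6 * ℓ / ℓ ^ 4| ≤ C₆ * ℓ ^ 6 / ℓ ^ 4)
    (h5 : |S₅ - K * Φ₅ * ℓ ^ 5 * ℓ / ℓ ^ 4| ≤ C₅ * ℓ ^ 5 / ℓ ^ 4)
    (h4 : |S₄ - K * Φ₄ * ℓ ^ 4 * ℓ / ℓ ^ 4| ≤ C₄ * ℓ ^ 4 / ℓ ^ 4)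
    (h3 : |S₃ - K * Φ₃ * ℓ ^ 3 * ℓ / ℓ ^ 4| ≤ C₃ * ℓ ^ 3 / ℓ ^ 4)
    (h2 : |S₂ - K * Φ₂ * ℓ ^ 2 * ℓ / ℓ ^ 4| ≤ C₂ * ℓ ^ 2 / ℓ ^ 4)
    (h1 : |S₁ - K * Φ₁ * ℓ ^ 1 * ℓ / ℓ ^ 4| ≤ C₁ * ℓ ^ 1 / ℓ ^ 4)
    (h0 : |S₀ - K * Φ₀ * ℓ ^ 0 * ℓ / ℓ ^ 4| ≤ C₀ * ℓ ^ 0 / ℓ ^ 4)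
    (g5 : |T₅ - K * Ψ₅ * ℓ ^ 5 * ℓ / ℓ ^ 2| ≤ D₅ * ℓ ^ 5 / ℓ ^ 2)
    (g4 : |T₄ - K * Ψ₄ * ℓ ^ 4 * ℓ / ℓ ^ 2| ≤ D₄ * ℓ ^ 4 / ℓ ^ 2)
    (g3 : |T₃ - K * Ψ₃ * ℓ ^ 3 * ℓ / ℓ ^ 2| ≤ D₃ * ℓ ^ 3 / ℓ ^ 2)
    (g2 : |T₂ - K * Ψ₂ * ℓ ^ 2 * ℓ / ℓ ^ 2| ≤ D₂ * ℓ ^ 2 / ℓ ^ 2)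
    (g1 : |T₁ - K * Ψ₁ * ℓ ^ 1 * ℓ / ℓ ^ 2| ≤ D₁ * ℓ ^ 1 / ℓ ^ 2)
    (g0 : |T₀ - K * Ψ₀ * ℓ ^ 0 * ℓ / ℓ ^ 2| ≤ D₀ * ℓ ^ 0 / ℓ ^ 2)
    (g5p : |T₅' - K * Ψ₅ * ℓ ^ 5 * ℓ / ℓ ^ 2| ≤ D₅' * ℓ ^ 5 / ℓ ^ 2)
    (g4p : |T₄' - K * Ψ₄ * ℓ ^ 4 * ℓ / ℓ ^ 2| ≤ D₄' * ℓ ^ 4 / ℓ ^ 2)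
    (g3p : |T₃' - K * Ψ₃ * ℓ ^ 3 * ℓ / ℓ ^ 2| ≤ D₃' * ℓ ^ 3 / ℓ ^ 2)
    (g2p : |T₂' - K * Ψ₂ * ℓ ^ 2 * ℓ / ℓ ^ 2| ≤ D₂' * ℓ ^ 2 / ℓ ^ 2)
    (g1p : |T₁' - K * Ψ₁ * ℓ ^ 1 * ℓ / ℓ ^ 2| ≤ D₁' * ℓ ^ 1 / ℓ ^ 2)
    (g0p : |T₀' - K * Ψ₀ * ℓ ^ 0 * ℓ / ℓ ^ 2| ≤ D₀' * ℓ ^ 0 / ℓ ^ 2)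
    (u3 : |U₃ - K * Ξ₃ * ℓ ^ 3 * ℓ / ℓ ^ 0| ≤ G₃ * ℓ ^ 3 / ℓ ^ 0)
    (u2 : |U₂ - K * Ξ₂ * ℓ ^ 2 * ℓ / ℓ ^ 0| ≤ G₂ * ℓ ^ 2 / ℓ ^ 0)
    (u1 : |U₁ - K * Ξ₁ * ℓ ^ 1 * ℓ / ℓ ^ 0| ≤ G₁ * ℓ ^ 1 / ℓ ^ 0)
    (u0 : |U₀ - K * Ξ₀ * ℓ ^ 0 * ℓ / ℓ ^ 0| ≤ G₀ * ℓ ^ 0 / ℓ ^ 0)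
    (a3 : |V₃| ≤ A₃ * ℓ ^ 3)
    (a2 : |V₂| ≤ A₂ * ℓ ^ 2)
    (a1 : |V₁| ≤ A₁ * ℓ ^ 1)
    (a0 : |V₀| ≤ A₀ * ℓ ^ 0)
    (b3 : |W₃| ≤ B₃ * ℓ ^ 3)
    (b2 : |W₂| ≤ B₂ * ℓ ^ 2)
    (b1 : |W₁| ≤ B₁ * ℓ ^ 1)
    (b0 : |W₀| ≤ B₀ * ℓ ^ 0)
    (y1 : |Y₁| ≤ CY₁ * ℓ ^ (1 + 2))
    (y0 : |Y₀| ≤ CY₀ * ℓ ^ (0 + 2))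
    (z1 : |Z₁| ≤ CZ₁ * ℓ ^ (1 + 2))
    (z0 : |Z₀| ≤ CZ₀ * ℓ ^ (0 + 2))
    (r1 : |R₁| ≤ CR₁ * ℓ ^ (1 + 2))
    (r0 : |R₀| ≤ CR₀ * ℓ ^ (0 + 2))
    (r1p : |R₁'| ≤ CR₁' * ℓ ^ (1 + 2))
    (r0p : |R₀'| ≤ CR₀' * ℓ ^ (0 + 2)) :
    |((1 / 896) * S₇ +
        (E₀₀ / 64) * S₆ +
        (3 * E₀₁ / 32 + 3 * E₁₀ / 32 - 3 * μ₂ / 40) * S₅ +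
        (3 * E₀₂ / 16 + 9 * E₁₁ / 16 + 3 * E₂₀ / 16) * S₄ +
        (E₀₃ / 8 + 9 * E₁₂ / 8 + 9 * E₂₁ / 8 + E₃₀ / 8 + μ₄ / 2) * S₃ +
        (3 * E₁₃ / 4 + 9 * E₂₂ / 4 + 3 * E₃₁ / 4) * S₂ +
        (3 * E₂₃ / 2 + 3 * E₃₂ / 2 - 2 * μ₆) * S₁ +
        E₃₃ * S₀ +
        (-3 / 640) * T₅ +
        (-3 * E₀₀ / 64) * T₄ +
        (-3 * E₀₁ / 16 - 3 * E₁₀ / 16 + 3 * μ₂ / 4) * T₃ +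
        (-9 * E₁₁ / 8) * T₂ +
        (3 * E₀₃ / 8 - 9 * E₁₂ / 8 - 9 * E₂₁ / 8 + 3 * E₃₀ / 8 - 15 * μ₄ / 2) * T₁ +
        (3 * E₁₃ / 4 - 9 * E₂₂ / 4 + 3 * E₃₁ / 4) * T₀ +
        (-3 / 640) * T₅' +
        (-3 * E₀₀ / 64) * T₄' +
        (-3 * E₀₁ / 16 - 3 * E₁₀ / 16 + 3 * μ₂ / 4) * T₃' +
        (-9 * E₁₁ / 8) * T₂' +
        (3 * E₀₃ / 8 - 9 * E₁₂ / 8 - 9 * E₂₁ / 8 + 3 * E₃₀ / 8 - 15 * μ₄ / 2) * T₁' +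
        (3 * E₁₃ / 4 - 9 * E₂₂ / 4 + 3 * E₃₁ / 4) * T₀' +
        (3 / 64) * U₃ +
        (9 * E₀₀ / 32) * U₂ +
        (9 * E₀₁ / 16 + 9 * E₁₀ / 16 - 45 * μ₂ / 4) * U₁ +
        (-9 * E₀₂ / 8 + 27 * E₁₁ / 8 - 9 * E₂₀ / 8) * U₀ +
        (1 / 128) * V₃ +
        (3 * E₀₀ / 64) * V₂ +
        (3 * E₀₁ / 32 + 3 * E₁₀ / 32 - 15 * μ₂ / 8) * V₁ +
        (-3 * E₀₂ / 16 + 9 * E₁₁ / 16 - 3 * E₂₀ / 16) * V₀ +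
        (1 / 128) * W₃ +
        (3 * E₀₀ / 64) * W₂ +
        (3 * E₀₁ / 32 + 3 * E₁₀ / 32 - 15 * μ₂ / 8) * W₁ +
        (-3 * E₀₂ / 16 + 9 * E₁₁ / 16 - 3 * E₂₀ / 16) * W₀ +
        (-1 / 128) * Y₁ +
        (-E₀₀ / 64) * Y₀ +
        (-1 / 128) * Z₁ +
        (-E₀₀ / 64) * Z₀ +
        (-15 / 128) * R₁ +
        (-15 * E₀₀ / 64) * R₀ +
        (-15 / 128) * R₁' +
        (-15 * E₀₀ / 64) * R₀') -
        K * ((1 / 896) * Φ₇ + (-3 / 320) * Ψ₅ + (3 / 64) * Ξ₃) * ℓ ^ 4| ≤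
      (|((1 / 896) : ℝ)| * C₇ +
        |((E₀₀ / 64) : ℝ)| * (K * |Φ₆| + C₆) +
        |((3 * E₀₁ / 32 + 3 * E₁₀ / 32 - 3 * μ₂ / 40) : ℝ)| * (K * |Φ₅| + C₅) +
        |((3 * E₀₂ / 16 + 9 * E₁₁ / 16 + 3 * E₂₀ / 16) : ℝ)| * (K * |Φ₄| + C₄) +
        |((E₀₃ / 8 + 9 * E₁₂ / 8 + 9 * E₂₁ / 8 + E₃₀ / 8 + μ₄ / 2) : ℝ)| * (K * |Φ₃| + C₃) +
        |((3 * E₁₃ / 4 + 9 * E₂₂ / 4 + 3 * E₃₁ / 4) : ℝ)| * (K * |Φ₂| + C₂) +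
        |((3 * E₂₃ / 2 + 3 * E₃₂ / 2 - 2 * μ₆) : ℝ)| * (K * |Φ₁| + C₁) +
        |(E₃₃ : ℝ)| * (K * |Φ₀| + C₀) +
        |((-3 / 640) : ℝ)| * D₅ +
        |((-3 * E₀₀ / 64) : ℝ)| * (K * |Ψ₄| + D₄) +
        |((-3 * E₀₁ / 16 - 3 * E₁₀ / 16 + 3 * μ₂ / 4) : ℝ)| * (K * |Ψ₃| + D₃) +
        |((-9 * E₁₁ / 8) : ℝ)| * (K * |Ψ₂| + D₂) +
        |((3 * E₀₃ / 8 - 9 * E₁₂ / 8 - 9 * E₂₁ / 8 + 3 * E₃₀ / 8 - 15 * μ₄ / 2) : ℝ)| * (K * |Ψ₁| + D₁) +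
        |((3 * E₁₃ / 4 - 9 * E₂₂ / 4 + 3 * E₃₁ / 4) : ℝ)| * (K * |Ψ₀| + D₀) +
        |((-3 / 640) : ℝ)| * D₅' +
        |((-3 * E₀₀ / 64) : ℝ)| * (K * |Ψ₄| + D₄') +
        |((-3 * E₀₁ / 16 - 3 * E₁₀ / 16 + 3 * μ₂ / 4) : ℝ)| * (K * |Ψ₃| + D₃') +
        |((-9 * E₁₁ / 8) : ℝ)| * (K * |Ψ₂| + D₂') +
        |((3 * E₀₃ / 8 - 9 * E₁₂ / 8 - 9 * E₂₁ / 8 + 3 * E₃₀ / 8 - 15 * μ₄ / 2) : ℝ)| * (K * |Ψ₁| + D₁') +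
        |((3 * E₁₃ / 4 - 9 * E₂₂ / 4 + 3 * E₃₁ / 4) : ℝ)| * (K * |Ψ₀| + D₀') +
        |((3 / 64) : ℝ)| * G₃ +
        |((9 * E₀₀ / 32) : ℝ)| * (K * |Ξ₂| + G₂) +
        |((9 * E₀₁ / 16 + 9 * E₁₀ / 16 - 45 * μ₂ / 4) : ℝ)| * (K * |Ξ₁| + G₁) +
        |((-9 * E₀₂ / 8 + 27 * E₁₁ / 8 - 9 * E₂₀ / 8) : ℝ)| * (K * |Ξ₀| + G₀) +
        |((1 / 128) : ℝ)| * A₃ +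
        |((3 * E₀₀ / 64) : ℝ)| * A₂ +
        |((3 * E₀₁ / 32 + 3 * E₁₀ / 32 - 15 * μ₂ / 8) : ℝ)| * A₁ +
        |((-3 * E₀₂ / 16 + 9 * E₁₁ / 16 - 3 * E₂₀ / 16) : ℝ)| * A₀ +
        |((1 / 128) : ℝ)| * B₃ +
        |((3 * E₀₀ / 64) : ℝ)| * B₂ +
        |((3 * E₀₁ / 32 + 3 * E₁₀ / 32 - 15 * μ₂ / 8) : ℝ)| * B₁ +
        |((-3 * E₀₂ / 16 + 9 * E₁₁ / 16 - 3 * E₂₀ / 16) : ℝ)| * B₀ +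
        |((-1 / 128) : ℝ)| * CY₁ +
        |((-E₀₀ / 64) : ℝ)| * CY₀ +
        |((-1 / 128) : ℝ)| * CZ₁ +
        |((-E₀₀ / 64) : ℝ)| * CZ₀ +
        |((-15 / 128) : ℝ)| * CR₁ +
        |((-15 * E₀₀ / 64) : ℝ)| * CR₀ +
        |((-15 / 128) : ℝ)| * CR₁' +
        |((-15 * E₀₀ / 64) : ℝ)| * CR₀') * ℓ ^ 3 := by
  have q1 := poly33_piece_main ((1 / 896) : ℝ) hℓ rfl h7
  have q2 := poly33_piece_low ((E₀₀ / 64) : ℝ) hℓ hK hC₆ (by norm_num) h6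
  have q3 := poly33_piece_low ((3 * E₀₁ / 32 + 3 * E₁₀ / 32 - 3 * μ₂ / 40) : ℝ) hℓ hK hC₅ (by norm_num) h5
  have q4 := poly33_piece_low ((3 * E₀₂ / 16 + 9 * E₁₁ / 16 + 3 * E₂₀ / 16) : ℝ) hℓ hK hC₄ (by norm_num) h4
  have q5 := poly33_piece_low ((E₀₃ / 8 + 9 * E₁₂ / 8 + 9 * E₂₁ / 8 + E₃₀ / 8 + μ₄ / 2) : ℝ) hℓ hK hC₃ (by norm_num) h3
  have q6 := poly33_piece_low ((3 * E₁₃ / 4 + 9 * E₂₂ / 4 + 3 * E₃₁ / 4) : ℝ) hℓ hK hC₂ (by norm_num) h2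
  have q7 := poly33_piece_low ((3 * E₂₃ / 2 + 3 * E₃₂ / 2 - 2 * μ₆) : ℝ) hℓ hK hC₁ (by norm_num) h1
  have q8 := poly33_piece_low (E₃₃ : ℝ) hℓ hK hC₀ (by norm_num) h0
  have q9 := poly33_piece_main ((-3 / 640) : ℝ) hℓ rfl g5
  have q10 := poly33_piece_low ((-3 * E₀₀ / 64) : ℝ) hℓ hK hD₄ (by norm_num) g4
  have q11 := poly33_piece_low ((-3 * E₀₁ / 16 - 3 * E₁₀ / 16 + 3 * μ₂ / 4) : ℝ) hℓ hK hD₃ (by norm_num) g3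
  have q12 := poly33_piece_low ((-9 * E₁₁ / 8) : ℝ) hℓ hK hD₂ (by norm_num) g2
  have q13 := poly33_piece_low ((3 * E₀₃ / 8 - 9 * E₁₂ / 8 - 9 * E₂₁ / 8 + 3 * E₃₀ / 8 - 15 * μ₄ / 2) : ℝ) hℓ hK hD₁ (by norm_num) g1
  have q14 := poly33_piece_low ((3 * E₁₃ / 4 - 9 * E₂₂ / 4 + 3 * E₃₁ / 4) : ℝ) hℓ hK hD₀ (by norm_num) g0
  have q15 := poly33_piece_main ((-3 / 640) : ℝ) hℓ rfl g5p
  have q16 := poly33_piece_low ((-3 * E₀₀ / 64) : ℝ) hℓ hK hD₄' (by norm_num) g4p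
  have q17 := poly33_piece_low ((-3 * E₀₁ / 16 - 3 * E₁₀ / 16 + 3 * μ₂ / 4) : ℝ) hℓ hK hD₃' (by norm_num) g3p
  have q18 := poly33_piece_low ((-9 * E₁₁ / 8) : ℝ) hℓ hK hD₂' (by norm_num) g2p
  have q19 := poly33_piece_low ((3 * E₀₃ / 8 - 9 * E₁₂ / 8 - 9 * E₂₁ / 8 + 3 * E₃₀ / 8 - 15 * μ₄ / 2) : ℝ) hℓ hK hD₁' (by norm_num) g1p
  have q20 := poly33_piece_low ((3 * E₁₃ / 4 - 9 * E₂₂ / 4 + 3 * E₃₁ / 4) : ℝ) hℓ hK hD₀' (by norm_num) g0p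
  have q21 := poly33_piece_main ((3 / 64) : ℝ) hℓ rfl u3
  have q22 := poly33_piece_low ((9 * E₀₀ / 32) : ℝ) hℓ hK hG₂ (by norm_num) u2
  have q23 := poly33_piece_low ((9 * E₀₁ / 16 + 9 * E₁₀ / 16 - 45 * μ₂ / 4) : ℝ) hℓ hK hG₁ (by norm_num) u1
  have q24 := poly33_piece_low ((-9 * E₀₂ / 8 + 27 * E₁₁ / 8 - 9 * E₂₀ / 8) : ℝ) hℓ hK hG₀ (by norm_num) u0
  have q25 := poly33_piece_hyp ((1 / 128) : ℝ) hℓ (by norm_num) a3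
  have q26 := poly33_piece_hyp ((3 * E₀₀ / 64) : ℝ) hℓ (by norm_num) a2
  have q27 := poly33_piece_hyp ((3 * E₀₁ / 32 + 3 * E₁₀ / 32 - 15 * μ₂ / 8) : ℝ) hℓ (by norm_num) a1
  have q28 := poly33_piece_hyp ((-3 * E₀₂ / 16 + 9 * E₁₁ / 16 - 3 * E₂₀ / 16) : ℝ) hℓ (by norm_num) a0
  have q29 := poly33_piece_hyp ((1 / 128) : ℝ) hℓ (by norm_num) b3
  have q30 := poly33_piece_hyp ((3 * E₀₀ / 64) : ℝ) hℓ (by norm_num) b2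
  have q31 := poly33_piece_hyp ((3 * E₀₁ / 32 + 3 * E₁₀ / 32 - 15 * μ₂ / 8) : ℝ) hℓ (by norm_num) b1
  have q32 := poly33_piece_hyp ((-3 * E₀₂ / 16 + 9 * E₁₁ / 16 - 3 * E₂₀ / 16) : ℝ) hℓ (by norm_num) b0
  have q33 := poly33_piece_hyp ((-1 / 128) : ℝ) hℓ (by norm_num) y1
  have q34 := poly33_piece_hyp ((-E₀₀ / 64) : ℝ) hℓ (by norm_num) y0
  have q35 := poly33_piece_hyp ((-1 / 128) : ℝ) hℓ (by norm_num) z1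
  have q36 := poly33_piece_hyp ((-E₀₀ / 64) : ℝ) hℓ (by norm_num) z0
  have q37 := poly33_piece_hyp ((-15 / 128) : ℝ) hℓ (by norm_num) r1
  have q38 := poly33_piece_hyp ((-15 * E₀₀ / 64) : ℝ) hℓ (by norm_num) r0
  have q39 := poly33_piece_hyp ((-15 / 128) : ℝ) hℓ (by norm_num) r1p
  have q40 := poly33_piece_hyp ((-15 * E₀₀ / 64) : ℝ) hℓ (by norm_num) r0p
  have H2 := poly22_add_piece q1 q2
  have H3 := poly22_add_piece H2 q3
  have H4 := poly22_add_piece H3 q4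
  have H5 := poly22_add_piece H4 q5
  have H6 := poly22_add_piece H5 q6
  have H7 := poly22_add_piece H6 q7
  have H8 := poly22_add_piece H7 q8
  have H9 := poly22_add_piece H8 q9
  have H10 := poly22_add_piece H9 q10
  have H11 := poly22_add_piece H10 q11
  have H12 := poly22_add_piece H11 q12
  have H13 := poly22_add_piece H12 q13
  have H14 := poly22_add_piece H13 q14
  have H15 := poly22_add_piece H14 q15
  have H16 := poly22_add_piece H15 q16
  have H17 := poly22_add_piece H16 q17
  have H18 := poly22_add_piece H17 q18
  have H19 := poly22_add_piece H18 q19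
  have H20 := poly22_add_piece H19 q20
  have H21 := poly22_add_piece H20 q21
  have H22 := poly22_add_piece H21 q22
  have H23 := poly22_add_piece H22 q23
  have H24 := poly22_add_piece H23 q24
  have H25 := poly22_add_piece H24 q25
  have H26 := poly22_add_piece H25 q26
  have H27 := poly22_add_piece H26 q27
  have H28 := poly22_add_piece H27 q28
  have H29 := poly22_add_piece H28 q29
  have H30 := poly22_add_piece H29 q30
  have H31 := poly22_add_piece H30 q31
  have H32 := poly22_add_piece H31 q32
  have H33 := poly22_add_piece H32 q33
  have H34 := poly22_add_piece H33 q34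
  have H35 := poly22_add_piece H34 q35
  have H36 := poly22_add_piece H35 q36
  have H37 := poly22_add_piece H36 q37
  have H38 := poly22_add_piece H37 q38
  have H39 := poly22_add_piece H38 q39
  have H40 := poly22_add_piece H39 q40
  have hm : ∀ {x m₁ m₂ d : ℝ}, m₁ = m₂ → |x - m₁| ≤ d → |x - m₂| ≤ d := fun e h ↦ e ▸ h
  refine (hm ?_ H40).trans (le_of_eq ?_)
  · ring
  · ring

end Summit.Parity.GeneralizedHardyLittlewood.Theorems.MomentsBeyondDiagonal.DiagKernel

end
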